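import Summits.MatrixMultiplication.MatrixMultiplication.Theorems.ObstructionDescentUniversalOccurrenceTwoRectangleTwoTallTableaux
import Summits.MatrixMultiplication.MatrixMultiplication.Theorems.ObstructionDescentUniversalOccurrenceTwoRectangleTwoTallArith

set_option linter.dupNamespace false
set_option autoImplicit false

/-!
# Universal occurrence — two rectangles, THE TYPE `(2N-8, 4, 4)`, part AA: the value of a valid term (decomp-mm · lens 3 · gen 43)

Route `route-MatrixMultiplication-ObstructionDescent` (sub-problem `MatrixMultiplication`, `ω(ℂ) = 2`); SUPPORT for the crux
`NoOccurrenceObstruction` (`P_O`, item `stmt-MatrixMultiplication-29040`) through the universal-occurrence programme (NODE-g29…g43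
of the decomp-mm cell, lens 3).  Nothing here proves `ω = 2` or closes an item; no `def`, no `sorry`, standard axioms.

**The two-tall-pairs design** (K23 floor law, `δ = 2`, twist `H = {s₁, s₄}`): `M = e_T` for the two-tall-pairs tableau (part Y);
colouring `g = (0,1,2,0,1,2,0,…)`; block structure `p ↦ (X(p) mod 2, ⌊X(p)/2⌋)` with `X = (3 5)(9 11)`, i.e. core columns
`[(0,s₀),(1,s₀),(0,s₁)] ‖ [(1,s₂),(0,s₂),(1,s₁)] ‖ [(0,s₃),(1,s₃),(0,s₄)] ‖ [(1,s₅),(0,s₅),(1,s₄)]`.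

**Claim** (`twoTall_value_eq_one`).  For every VALID `σ` (`σ₀⁻¹σ₁` stabilises `{s₁,s₄}`), `e_T(g ∘ w_σ) ∈ {0, 1}`.  Proof: support
⟹ letters `< 3`, columns injective, `Σ_front A = 6`, the letter `1` twice among the front `A`; validity reads STRAIGHT
(`B₁ = A₁`, `B₄ = A₄`) or CROSSED (`B₁ = A₄`, `B₄ = A₁`).  Straight ⟹ (`twoTall_straight`) both pairs twin — a `(01)(23)`-twin
word — or both anti-twin — `(3 4)(9 10)` (even) makes it one; crossed ⟹ (`twoTall_cross`) a `(03)(12)`-twin word.  In all cases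
the pairing lemma of part Y gives `e_T = 1`.  (The `66` support configurations of the design all have value `+1`.)

[cite: BurgisserIkenmeyer2011, §3.4 (Prop. 3.4), Thm. 4.4] [cite: BurgisserIkenmeyer2017, §5, Thm. 5.9 (proof of (2)), eq. (3.4)]
-/

noncomputable section

open scoped BigOperators

namespace Summit.MatrixMultiplication.MatrixMultiplication.Theorems.ObstructionCalculus

open Literature.Computability.AlgebraicComplexity
open Literature.NumberTheory.DiophantineGeometry

set_option maxHeartbeats 400000 in
/-- The pairing lemma of part Y with the twin condition read on a letter table `W(n) = u(q n)`. [folklore] -/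
theorem twoTallTableau_eq_one_of_pairing_table {N : ℕ} {Y : YoungDiagram} (hN : ∀ x ∈ Y.cells, x.1 < N)
    (T : StdFilling (N * 2) Y)
    (hT : ∀ p : Fin (N * 2), T.1 p = (if (p : ℕ) < 12 then ((p : ℕ) % 3, (p : ℕ) / 3) else (0, (p : ℕ) - 8)))
    (h12 : 12 ≤ N * 2) {u : Word N (N * 2)}
    (harm : ∀ p : Fin (N * 2), 12 ≤ (p : ℕ) → ((u p : Fin N) : ℕ) = 0)
    (hlt3 : ∀ p : Fin (N * 2), ((u p : Fin N) : ℕ) < 3)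
    (hinj : ∀ p q : Fin (N * 2), (T.1 p).2 = (T.1 q).2 → u p = u q → p = q)
    (q : Equiv.Perm (Fin (N * 2))) (hqC : q ∈ T.colStab) (hqs : Equiv.Perm.sign q = 1)
    (hqarm : ∀ p : Fin (N * 2), 12 ≤ (p : ℕ) → q p = p)
    (π : ℕ → ℕ) (hπlt : ∀ c, c < 4 → π c < 4) (hπi : ∀ c, c < 4 → π (π c) = c) (hπne : ∀ c, c < 4 → π c ≠ c)
    (W : ℕ → ℕ) (hW : ∀ x : Fin (N * 2), ((u (q x) : Fin N) : ℕ) = W x)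
    (htwin : ∀ n, n < 12 → W (3 * π (n / 3) + n % 3) = W n) :
    T.polytabloid ℂ hN u = 1 :=
  twoTallTableau_eq_one_of_pairing hN T hT h12 harm hlt3 hinj q hqC hqs hqarm π hπlt hπi hπne
    (fun p hp => Fin.ext (by rw [hW, hW]; exact htwin p hp))

set_option maxHeartbeats 800000 in
/-- **A valid term of the two-tall-pairs design has `e_T(g ∘ w_σ) ∈ {0, 1}`.** [cite: BurgisserIkenmeyer2011, Thm. 4.4]
[cite: BurgisserIkenmeyer2017, Thm. 5.9 (proof of (2))] -/
theorem twoTall_value_eq_one {N : ℕ} (hN : 6 ≤ N) {Y : YoungDiagram}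
    (hNY : ∀ x ∈ Y.cells, x.1 < N) (T : StdFilling (N * 2) Y)
    (hT : ∀ p : Fin (N * 2), T.1 p = (if (p : ℕ) < 12 then ((p : ℕ) % 3, (p : ℕ) / 3) else (0, (p : ℕ) - 8)))
    (e : Fin (N * 2) ≃ Fin 2 × Fin N) (g : Fin N → Fin N)
    (hgv : ∀ i : Fin N, ((g i : Fin N) : ℕ) = if (i : ℕ) < 3 then (i : ℕ) else if (i : ℕ) < 6 then (i : ℕ) - 3 else 0)
    (hpos : ∀ (σ : Fin 2 → Equiv.Perm (Fin N)) (n : ℕ) (hn : n < N * 2) (a : Fin 2) (s : Fin N),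
      (if n = 3 then 5 else if n = 5 then 3 else if n = 9 then 11 else if n = 11 then 9 else n) % 2 = (a : ℕ) →
      (if n = 3 then 5 else if n = 5 then 3 else if n = 9 then 11 else if n = 11 then 9 else n) / 2 = (s : ℕ) →
      (g ∘ fun q => σ (e q).1 (e q).2) ⟨n, hn⟩ = g (σ a s))
    (H : Finset (Fin N)) (hHv : ∀ s : Fin N, s ∈ H ↔ ((s : ℕ) = 1 ∨ (s : ℕ) = 4))
    (s1 s4 : Fin N) (hs1 : (s1 : ℕ) = 1) (hs4 : (s4 : ℕ) = 4)
    (σ : Fin 2 → Equiv.Perm (Fin N)) (hval : ∀ s, (σ 0)⁻¹ (σ 1 s) ∈ H ↔ s ∈ H)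
    (hz : T.polytabloid ℂ hNY (g ∘ fun q => σ (e q).1 (e q).2) ≠ 0) :
    T.polytabloid ℂ hNY (g ∘ fun q => σ (e q).1 (e q).2) = 1 := by
  classical
  set v := (g ∘ fun q => σ (e q).1 (e q).2) with hv
  have hcolT : ∀ q : Fin (N * 2), (T.1 q).2 = if (q : ℕ) < 12 then (q : ℕ) / 3 else (q : ℕ) - 8 :=
    fun q => by rw [hT]; split_ifs <;> rfl
  obtain ⟨harm, hlt3, hinj⟩ := twoTallTableau_support hNY T hT hz
  have hNpos : 0 < N * 2 := by omega
  let P : ℕ → Fin (N * 2) := fun n => ⟨n % (N * 2), Nat.mod_lt _ hNpos⟩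
  have hP : ∀ n, n < N * 2 → ((P n : Fin (N * 2)) : ℕ) = n := fun n hn => Nat.mod_eq_of_lt hn
  let U : ℕ → ℕ := fun n => ((v (P n) : Fin N) : ℕ)
  have hU : ∀ (n : ℕ) (hn : n < N * 2), ((v ⟨n, hn⟩ : Fin N) : ℕ) = U n := by
    intro n hn
    show _ = ((v (P n) : Fin N) : ℕ)
    rw [show (⟨n, hn⟩ : Fin (N * 2)) = P n from Fin.ext (hP n hn).symm]
  have hUp : ∀ x : Fin (N * 2), ((v x : Fin N) : ℕ) = U x := fun x => hU x.1 x.2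
  have hU3 : ∀ n, U n < 3 := fun n => hlt3 _
  -- letters in one column are distinct
  have hcolne : ∀ n n', n < N * 2 → n' < N * 2 → n ≠ n' →
      (if n < 12 then n / 3 else n - 8) = (if n' < 12 then n' / 3 else n' - 8) → U n ≠ U n' := by
    intro n n' hn hn' hne hc h
    have h' : v (P n) = v (P n') := Fin.ext h
    have := hinj (P n) (P n') (by rw [hcolT, hcolT, hP _ hn, hP _ hn']; exact hc) h'
    have := congrArg Fin.val this
    rw [hP _ hn, hP _ hn'] at this
    exact hne this
  have d01 := hcolne 0 1 (by omega) (by omega) (by omega) (by simp)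
  have d02 := hcolne 0 2 (by omega) (by omega) (by omega) (by simp)
  have d12 := hcolne 1 2 (by omega) (by omega) (by omega) (by simp)
  have d34 := hcolne 3 4 (by omega) (by omega) (by omega) (by simp)
  have d35 := hcolne 3 5 (by omega) (by omega) (by omega) (by simp)
  have d45 := hcolne 4 5 (by omega) (by omega) (by omega) (by simp)
  have d67 := hcolne 6 7 (by omega) (by omega) (by omega) (by simp)
  have d68 := hcolne 6 8 (by omega) (by omega) (by omega) (by simp)
  have d78 := hcolne 7 8 (by omega) (by omega) (by omega) (by simp)
  have d910 := hcolne 9 10 (by omega) (by omega) (by omega) (by simp)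
  have d911 := hcolne 9 11 (by omega) (by omega) (by omega) (by simp)
  have d1011 := hcolne 10 11 (by omega) (by omega) (by omega) (by simp)
  -- reading the letters through `hpos`
  have rd : ∀ (n : ℕ) (hn : n < N * 2) (a : Fin 2) (s : Fin N),
      (if n = 3 then 5 else if n = 5 then 3 else if n = 9 then 11 else if n = 11 then 9 else n) % 2 = (a : ℕ) →
      (if n = 3 then 5 else if n = 5 then 3 else if n = 9 then 11 else if n = 11 then 9 else n) / 2 = (s : ℕ) →
      U n = ((g (σ a s) : Fin N) : ℕ) := by
    intro n hn a s ha hs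
    rw [← hU n hn]
    exact congrArg Fin.val (by rw [hv]; exact hpos σ n hn a s ha hs)
  -- validity: straight (`B₁ = A₁`, `B₄ = A₄`) or crossed (`B₁ = A₄`, `B₄ = A₁`)
  have hi0 : ∀ x, σ 0 ((σ 0)⁻¹ x) = x := fun x => (σ 0).apply_symm_apply x
  have hV : (U 5 = U 2 ∧ U 11 = U 8) ∨ (U 5 = U 8 ∧ U 11 = U 2) := by
    obtain ⟨t1, ht1⟩ : ∃ t, σ 0 t = σ 1 s1 := ⟨_, hi0 _⟩
    obtain ⟨t4, ht4⟩ : ∃ t, σ 0 t = σ 1 s4 := ⟨_, hi0 _⟩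
    have k1 : (σ 0)⁻¹ (σ 1 s1) = t1 := (σ 0).injective (by rw [hi0, ht1])
    have k4 : (σ 0)⁻¹ (σ 1 s4) = t4 := (σ 0).injective (by rw [hi0, ht4])
    have m1 : (t1 : ℕ) = 1 ∨ (t1 : ℕ) = 4 :=
      (hHv t1).1 (by rw [← k1]; exact (hval s1).2 ((hHv s1).2 (Or.inl hs1)))
    have m4 : (t4 : ℕ) = 1 ∨ (t4 : ℕ) = 4 :=
      (hHv t4).1 (by rw [← k4]; exact (hval s4).2 ((hHv s4).2 (Or.inr hs4)))
    have hne : (t1 : ℕ) ≠ (t4 : ℕ) := fun h => by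
      have h' : σ 1 s1 = σ 1 s4 := by rw [← ht1, ← ht4, show t1 = t4 from Fin.ext h]
      have := congrArg Fin.val ((σ 1).injective h')
      rw [hs1, hs4] at this; omega
    have r5 := rd 5 (by omega) 1 s1 (by simp) (by simp [hs1])
    have r2 := rd 2 (by omega) 0 s1 (by simp) (by simp [hs1])
    have r11 := rd 11 (by omega) 1 s4 (by simp) (by simp [hs4])
    have r8 := rd 8 (by omega) 0 s4 (by simp) (by simp [hs4])
    rcases m1 with h1 | h1 <;> rcases m4 with h4 | h4
    · exact absurd (h1.trans h4.symm) hne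
    · have e1 : t1 = s1 := Fin.ext (h1.trans hs1.symm)
      have e4 : t4 = s4 := Fin.ext (h4.trans hs4.symm)
      exact Or.inl ⟨by rw [r5, r2, ← ht1, e1], by rw [r11, r8, ← ht4, e4]⟩
    · have e1 : t1 = s4 := Fin.ext (h1.trans hs4.symm)
      have e4 : t4 = s1 := Fin.ext (h4.trans hs1.symm)
      exact Or.inr ⟨by rw [r5, r8, ← ht1, e1], by rw [r11, r2, ← ht4, e4]⟩
    · exact absurd (h1.trans h4.symm) hne
  -- the colour sum of block `0` and the letter `1` twice in block `0`
  have hsumA : U 0 + U 2 + U 4 + U 6 + U 8 + U 10 = 6 := by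
    have h : ∑ s : Fin N, ((g (σ 0 s) : Fin N) : ℕ) = 6 := by
      rw [Equiv.sum_comp (σ 0) (fun x => ((g x : Fin N) : ℕ))]
      exact sum_twoTallColouring_eq hN (fun i => ((g i : Fin N) : ℕ)) hgv
    rw [sum_slots_six_eq hN _ (fun s hs => by
      have h0 : U (2 * s) = 0 := harm (P (2 * s)) (by rw [hP _ (by omega)]; omega)
      rw [← rd (2 * s) (by omega) 0 s (by split_ifs <;> simp <;> omega) (by split_ifs <;> omega), h0])] at h
    rw [← rd 0 (by omega) 0 ⟨0, by omega⟩ (by simp) (by simp), ← rd 2 (by omega) 0 ⟨1, by omega⟩ (by simp) (by simp),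
      ← rd 4 (by omega) 0 ⟨2, by omega⟩ (by simp) (by simp), ← rd 6 (by omega) 0 ⟨3, by omega⟩ (by simp) (by simp),
      ← rd 8 (by omega) 0 ⟨4, by omega⟩ (by simp) (by simp), ← rd 10 (by omega) 0 ⟨5, by omega⟩ (by simp) (by simp)] at h
    exact h
  have hone : (if U 0 = 1 then 1 else 0) + (if U 2 = 1 then 1 else 0) + (if U 4 = 1 then 1 else 0) +
      (if U 6 = 1 then 1 else 0) + (if U 8 = 1 then 1 else 0) + (if U 10 = 1 then 1 else 0) = 2 := by
    have h : ∑ s : Fin N, (if ((g (σ 0 s) : Fin N) : ℕ) = 1 then 1 else 0) = 2 := by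
      rw [Equiv.sum_comp (σ 0) (fun x => if ((g x : Fin N) : ℕ) = 1 then 1 else 0)]
      exact sum_twoTallIndicator_eq hN (fun i => ((g i : Fin N) : ℕ)) hgv
    rw [sum_slots_six_eq hN _ (fun s hs => by
      have h0 : U (2 * s) = 0 := harm (P (2 * s)) (by rw [hP _ (by omega)]; omega)
      rw [← rd (2 * s) (by omega) 0 s (by split_ifs <;> simp <;> omega) (by split_ifs <;> omega), h0]
      rw [if_neg (by omega)])] at h
    rw [← rd 0 (by omega) 0 ⟨0, by omega⟩ (by simp) (by simp), ← rd 2 (by omega) 0 ⟨1, by omega⟩ (by simp) (by simp),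
      ← rd 4 (by omega) 0 ⟨2, by omega⟩ (by simp) (by simp), ← rd 6 (by omega) 0 ⟨3, by omega⟩ (by simp) (by simp),
      ← rd 8 (by omega) 0 ⟨4, by omega⟩ (by simp) (by simp), ← rd 10 (by omega) 0 ⟨5, by omega⟩ (by simp) (by simp)] at h
    exact h
  have hb0 := hU3 0; have hb1 := hU3 1; have hb2 := hU3 2; have hb3 := hU3 3; have hb4 := hU3 4
  have hb6 := hU3 6; have hb7 := hU3 7; have hb8 := hU3 8; have hb9 := hU3 9; have hb10 := hU3 10
  -- the two pairings of the four front columns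
  let πs : ℕ → ℕ := fun c => if c = 0 then 1 else if c = 1 then 0 else if c = 2 then 3 else if c = 3 then 2 else c
  have hπs : ∀ c, πs c = if c = 0 then 1 else if c = 1 then 0 else if c = 2 then 3 else if c = 3 then 2 else c :=
    fun c => rfl
  let πc : ℕ → ℕ := fun c => if c = 0 then 3 else if c = 1 then 2 else if c = 2 then 1 else if c = 3 then 0 else c
  have hπc : ∀ c, πc c = if c = 0 then 3 else if c = 1 then 2 else if c = 2 then 1 else if c = 3 then 0 else c :=
    fun c => rfl
  -- STRAIGHT configurations
  have straight : U 5 = U 2 → U 11 = U 8 → T.polytabloid ℂ hNY v = 1 := by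
    intro v1 v4
    have halph := twoTall_straight (U 0) (U 1) (U 2) (U 3) (U 4) (U 6) (U 7) (U 8) (U 9) (U 10)
      hb0 hb1 hb2 hb3 hb4 hb6 hb7 hb8 hb9 hb10 d01 d02 d12 d34 (by rw [← v1]; exact d35) (by rw [← v1]; exact d45)
      d67 d68 d78 d910 (by rw [← v4]; exact d911) (by rw [← v4]; exact d1011) hsumA
    rcases halph with ⟨t30, t41, t96, t107⟩ | ⟨t31, t40, t97, t106⟩
    · -- both pairs twin: `v` is a `(01)(23)`-twin word
      refine twoTallTableau_eq_one_of_pairing_table hNY T hT (by omega) harm hlt3 hinj 1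
        (StdFilling.one_mem_colStab T) Equiv.Perm.sign_one (fun p _ => rfl) πs
        (fun c hc => by interval_cases c <;> simp [hπs]) (fun c hc => by interval_cases c <;> simp [hπs])
        (fun c hc => by interval_cases c <;> simp [hπs]) U (fun x => hUp x) ?_
      intro n hn
      interval_cases n <;> norm_num [hπs] <;> first | assumption | (symm; assumption)
    · -- both pairs anti-twin: `(3 4)(9 10)` makes `v` a `(01)(23)`-twin word
      obtain ⟨p3, hp3⟩ : ∃ p : Fin (N * 2), (p : ℕ) = 3 := ⟨⟨3, by omega⟩, rfl⟩
      obtain ⟨p4, hp4⟩ : ∃ p : Fin (N * 2), (p : ℕ) = 4 := ⟨⟨4, by omega⟩, rfl⟩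
      obtain ⟨p9, hp9⟩ : ∃ p : Fin (N * 2), (p : ℕ) = 9 := ⟨⟨9, by omega⟩, rfl⟩
      obtain ⟨p10, hp10⟩ : ∃ p : Fin (N * 2), (p : ℕ) = 10 := ⟨⟨10, by omega⟩, rfl⟩
      have h34 : p3 ≠ p4 := fun h => by have := congrArg Fin.val h; omega
      have h910 : p9 ≠ p10 := fun h => by have := congrArg Fin.val h; omega
      have hne : ∀ (x y : Fin (N * 2)) (m : ℕ), (y : ℕ) = m → (x : ℕ) ≠ m → x ≠ y :=
        fun x y m hy hx h => hx (by rw [h, hy])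
      set q : Equiv.Perm (Fin (N * 2)) := Equiv.swap p3 p4 * Equiv.swap p9 p10 with hq
      have hqv : ∀ x, q x = Equiv.swap p3 p4 (Equiv.swap p9 p10 x) := fun x => rfl
      have hqx : ∀ x : Fin (N * 2), ((q x : Fin (N * 2)) : ℕ) =
          if (x : ℕ) = 3 then 4 else if (x : ℕ) = 4 then 3 else if (x : ℕ) = 9 then 10 else if (x : ℕ) = 10 then 9
          else (x : ℕ) := by
        intro x
        rw [hqv]
        by_cases h9 : x = p9
        · subst h9
          rw [Equiv.swap_apply_left, Equiv.swap_apply_of_ne_of_ne (hne _ _ 3 hp3 (by omega)) (hne _ _ 4 hp4 (by omega)),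
            hp10, hp9]; simp
        by_cases h10 : x = p10
        · subst h10
          rw [Equiv.swap_apply_right, Equiv.swap_apply_of_ne_of_ne (hne _ _ 3 hp3 (by omega)) (hne _ _ 4 hp4 (by omega)),
            hp9, hp10]; simp
        rw [Equiv.swap_apply_of_ne_of_ne h9 h10]
        have hx9 : (x : ℕ) ≠ 9 := fun h => h9 (Fin.ext (by rw [h, hp9]))
        have hx10 : (x : ℕ) ≠ 10 := fun h => h10 (Fin.ext (by rw [h, hp10]))
        by_cases h3 : x = p3
        · subst h3; rw [Equiv.swap_apply_left, hp4, hp3]; simp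
        by_cases h4 : x = p4
        · subst h4; rw [Equiv.swap_apply_right, hp3, hp4]; simp
        have hx3 : (x : ℕ) ≠ 3 := fun h => h3 (Fin.ext (by rw [h, hp3]))
        have hx4 : (x : ℕ) ≠ 4 := fun h => h4 (Fin.ext (by rw [h, hp4]))
        rw [Equiv.swap_apply_of_ne_of_ne h3 h4, if_neg hx3, if_neg hx4, if_neg hx9, if_neg hx10]
      refine twoTallTableau_eq_one_of_pairing_table hNY T hT (by omega) harm hlt3 hinj q
        (StdFilling.mul_mem_colStab (StdFilling.swap_mem_colStab (by rw [hcolT, hcolT, hp3, hp4]; simp))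
          (StdFilling.swap_mem_colStab (by rw [hcolT, hcolT, hp9, hp10]; simp)))
        (by rw [hq, Equiv.Perm.sign_mul, Equiv.Perm.sign_swap h34, Equiv.Perm.sign_swap h910]; decide)
        (fun p hp => Fin.ext (by rw [hqx]; split_ifs <;> omega)) πs
        (fun c hc => by interval_cases c <;> simp [hπs]) (fun c hc => by interval_cases c <;> simp [hπs])
        (fun c hc => by interval_cases c <;> simp [hπs])
        (fun n => U (if n = 3 then 4 else if n = 4 then 3 else if n = 9 then 10 else if n = 10 then 9 else n))
        (fun x => by rw [hUp (q x), hqx]) ?_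
      intro n hn
      interval_cases n <;> norm_num [hπs] <;> first | assumption | (symm; assumption)
  rcases hV with ⟨v1, v4⟩ | ⟨v1, v4⟩
  · exact straight v1 v4
  by_cases h14 : U 2 = U 8
  · exact straight (v1.trans h14.symm) (v4.trans h14)
  -- CROSSED configurations: `v` is a `(03)(12)`-twin word
  obtain ⟨t63, t74, t90, t101⟩ := twoTall_cross (U 0) (U 1) (U 2) (U 3) (U 4) (U 6) (U 7) (U 8) (U 9) (U 10)
    hb0 hb1 hb2 hb3 hb4 hb6 hb7 hb8 hb9 hb10 d01 d02 d12 d34 (by rw [← v1]; exact d35) (by rw [← v1]; exact d45)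
    d67 d68 d78 d910 (by rw [← v4]; exact d911) (by rw [← v4]; exact d1011) h14 hsumA hone
  refine twoTallTableau_eq_one_of_pairing_table hNY T hT (by omega) harm hlt3 hinj 1
    (StdFilling.one_mem_colStab T) Equiv.Perm.sign_one (fun p _ => rfl) πc
    (fun c hc => by interval_cases c <;> simp [hπc]) (fun c hc => by interval_cases c <;> simp [hπc])
    (fun c hc => by interval_cases c <;> simp [hπc]) U (fun x => hUp x) ?_
  intro n hn
  interval_cases n <;> norm_num [hπc] <;> first | assumption | (symm; assumption)

end Summit.MatrixMultiplication.MatrixMultiplication.Theorems.ObstructionCalculus
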